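import Mathlib
import HarnessLib
import Summits.Ventures.LatticeQCDFlow.Exactness.NCMCGeneralSpaceTemperedAcceptance

/-!
# Consistency between the reported diagnostics: the switch acceptance and the ESS constrain each other

HONEST FRAMING: exact (Metropolis-corrected) sampling algorithms for lattice gauge theory;
figures of merit are autocorrelation/cost numbers at stated couplings and volumes; no
continuum-physics claim.

Venture `LatticeQCDFlow` (cell pub-lqcd), topic `Exactness`; FANOUT row 13 (`eng-snf`, GEN-11).
NEW WORK of the cell (general measure theory: two Cauchy–Schwarz inequalities on the forward path
law), not a published result; nothing is cited as a fact (the inequality `TV ≤ ½ √χ²` between total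
variation and the chi-square divergence is classical and named only; it is re-proved here in the cell's
variables).  Setting of `NCMCGeneralSpaceOverlap.lean` / `NCMCGeneralSpaceAcceptanceFloor.lean` /
`NCMCGeneralSpaceDissipation.lean`: a Crooks pair from `ν₀` to `ν₁`, `P_F`, `P_R`, `e^{−ΔF} = Z₁/Z₀`,
switch acceptance `acc = E_{P_F}[min(1, e^{−(W−ΔF)})] = 1 − TV(P_F, P_R)`, population ESS
`ESS_F = (E_F e^{−W})² / E_F e^{−2W} = 1 / E_F[e^{2(ΔF−W)}]`.

WHY.  A two-sided `latflow-snf` run reports BOTH an acceptance (`ncmc` / `acceptance_forward`) and a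
Kish ESS (`estimators.free_energy(...)['ess']`).  For an exact run the two population values are
not independent: this file gives the region a reported pair must lie in, for EVERY protocol certified
as a Crooks pair — a value-free audit inequality for the ref-exact review (a boarded pair outside the
region, beyond statistical error, flags a defect), and an ESS-only floor on the acceptance to put next
to the dissipation-only floor of `NCMCGeneralSpaceAcceptanceFloor.lean`.

## Content

* `sq_integral_mul_le` — Cauchy–Schwarz for real integrands, `(∫ f g)² ≤ ∫ f² · ∫ g²`, through the
  discriminant of `t ↦ ∫ (t f − g)²`.
* **`CrooksPair.four_mul_sq_one_sub_accept_le`** — `4 (1 − acc)² ≤ E_F[e^{−2W}] / (E_F e^{−W})² − 1`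
  (`= 1/ESS_F − 1`, the relative variance of the Jarzynski weight): the rejection rate is at most half
  the coefficient of variation of the weights (`TV = ½ E_F|1 − d| ≤ ½ √(E_F[d²] − 1)`, `d = e^{ΔF−W}`);
  `CrooksPair.one_sub_half_sqrt_le_accept` — the ESS-ONLY FLOOR `acc ≥ 1 − ½ √(1/ESS_F − 1)`.
* **`CrooksPair.essPop_le_sq_integral_exp_half`** — `ESS_F ≤ B²`, `B = E_F[e^{−(W−ΔF)/2}]` the
  half-work (Bhattacharyya) average (two Cauchy–Schwarz steps: `1 = E[u²] ≤ √(E u · E u³)`,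
  `E u³ ≤ √(E u² · E u⁴)`, `u = √d`); with `NCMCGeneralSpaceAcceptanceFloor.sq_integral_exp_half_le`
  (`B² ≤ acc (2 − acc)`): **`CrooksPair.essPop_le_accept_mul`** — `ESS_F ≤ acc (2 − acc)`, i.e.
  **`CrooksPair.one_sub_sqrt_one_sub_essPop_le_accept`** — `acc ≥ 1 − √(1 − ESS_F)` and, read the other
  way, `ESS_F ≤ 1 − (1 − acc)²`: a run cannot report a population ESS above what its rejection rate
  allows.

All statements assume the Jarzynski weight is square-integrable under `P_F` (`E_F e^{−2W} < ∞`, the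
regime in which `ESS_F > 0`); nothing is claimed about finite-sample fluctuations of the reported pair.
-/

namespace Summit.Ventures.LatticeQCDFlow.Exactness.GeneralNCMC

open MeasureTheory ProbabilityTheory Set Filter
open scoped ENNReal

variable {Ω E : Type*} [MeasurableSpace Ω] [MeasurableSpace E]

/-! ## Cauchy–Schwarz through a discriminant -/

/-- **Cauchy–Schwarz for real integrands**: `(∫ f g)² ≤ (∫ f²)(∫ g²)` whenever `f²`, `g²` and `f g`
are integrable (`0 ≤ ∫ (t f − g)² = t² ∫f² − 2t ∫fg + ∫g²` for every `t`). -/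
theorem sq_integral_mul_le {μ : Measure E} {f g : E → ℝ} (hf2 : Integrable (fun x => f x ^ 2) μ)
    (hg2 : Integrable (fun x => g x ^ 2) μ) (hfg : Integrable (fun x => f x * g x) μ) :
    (∫ x, f x * g x ∂μ) ^ 2 ≤ (∫ x, f x ^ 2 ∂μ) * ∫ x, g x ^ 2 ∂μ := by
  set a := ∫ x, f x ^ 2 ∂μ with ha
  set b := ∫ x, f x * g x ∂μ with hb
  set c := ∫ x, g x ^ 2 ∂μ with hc
  have hquad : ∀ t : ℝ, 0 ≤ a * (t * t) + (-2 * b) * t + c := by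
    intro t
    have hnn : 0 ≤ ∫ x, (t * f x - g x) ^ 2 ∂μ := integral_nonneg fun x => sq_nonneg _
    have hexp : ∀ x, (t * f x - g x) ^ 2 = t ^ 2 * f x ^ 2 - 2 * t * (f x * g x) + g x ^ 2 :=
      fun x => by ring
    simp_rw [hexp] at hnn
    have hI1 : Integrable (fun x => t ^ 2 * f x ^ 2 - 2 * t * (f x * g x)) μ :=
      (hf2.const_mul _).sub (hfg.const_mul _)
    rw [integral_add hI1 hg2, integral_sub (hf2.const_mul _) (hfg.const_mul _), integral_const_mul,
      integral_const_mul] at hnn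
    rw [← ha, ← hb, ← hc] at hnn
    nlinarith [hnn]
  have hdisc := discrim_le_zero hquad
  rw [discrim] at hdisc
  nlinarith [hdisc]

namespace CrooksPair

variable {ν₀ ν₁ : Measure Ω} {κF κR : Kernel Ω E} {s e : E → Ω} {W : E → ℝ}

/-! ## Bookkeeping: the density `d = e^{ΔF−W}` and its second moment -/

/-- With a square-integrable Jarzynski weight the density `d = e^{ΔF−W}` is square-integrable, and
`E_F[d²] = E_F[e^{−2W}] / (E_F e^{−W})²` (`= 1/ESS_F`). -/
theorem integral_density_sq_eq [IsFiniteMeasure ν₀] [IsFiniteMeasure ν₁] [IsMarkovKernel κF]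
    [IsMarkovKernel κR] (h0 : ν₀ univ ≠ 0) (h1 : ν₁ univ ≠ 0) (h : CrooksPair ν₀ ν₁ κF κR s e W)
    {ΔF : ℝ} (hΔF : Real.exp (-ΔF) = ((ν₀ univ)⁻¹ * ν₁ univ).toReal) :
    ∫ ε, Real.exp (ΔF - W ε) ^ 2 ∂(fwdPathLaw ν₀ κF) =
      (∫ ε, Real.exp (-(2 * W ε)) ∂(fwdPathLaw ν₀ κF)) / (∫ ε, Real.exp (-W ε) ∂(fwdPathLaw ν₀ κF)) ^ 2 := by
  have hr := toReal_ratio_pos (ν₀ := ν₀) (ν₁ := ν₁) h0 h1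
  rw [h.integral_exp_neg_work, ← hΔF]
  have hsplit : ∀ ε, Real.exp (ΔF - W ε) ^ 2 = (Real.exp (-ΔF) ^ 2)⁻¹ * Real.exp (-(2 * W ε)) := fun ε => by
    rw [sq, sq, ← Real.exp_add, ← Real.exp_add, ← Real.exp_neg, ← Real.exp_add]
    congr 1
    ring
  simp_rw [hsplit]
  rw [integral_const_mul, div_eq_inv_mul]

/-! ## The rejection rate against the relative variance of the weights -/

/-- **`4 (1 − acc)² ≤ E_F[e^{−2W}] / (E_F e^{−W})² − 1`** (`= 1/ESS_F − 1 = Var_F[e^{−W}]/(E_F e^{−W})²`):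
the rejection rate of the Metropolized switch at `c = ΔF` is at most half the coefficient of variation
of the Jarzynski weights (`1 − acc = ½ E_F|1 − d| ≤ ½ √(E_F[(1 − d)²])`, `E_F[d] = 1`).  Requires a
square-integrable weight. -/
theorem four_mul_sq_one_sub_accept_le [IsFiniteMeasure ν₀] [IsFiniteMeasure ν₁] [IsMarkovKernel κF]
    [IsMarkovKernel κR] (h0 : ν₀ univ ≠ 0) (h1 : ν₁ univ ≠ 0) (h : CrooksPair ν₀ ν₁ κF κR s e W)
    {ΔF : ℝ} (hΔF : Real.exp (-ΔF) = ((ν₀ univ)⁻¹ * ν₁ univ).toReal)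
    (hL2 : MemLp (fun ε => Real.exp (ΔF - W ε)) 2 (fwdPathLaw ν₀ κF)) :
    4 * (1 - ∫ ε, min 1 (Real.exp (-(W ε - ΔF))) ∂(fwdPathLaw ν₀ κF)) ^ 2 ≤
      (∫ ε, Real.exp (-(2 * W ε)) ∂(fwdPathLaw ν₀ κF)) / (∫ ε, Real.exp (-W ε) ∂(fwdPathLaw ν₀ κF)) ^ 2
        - 1 := by
  haveI := isProbabilityMeasure_fwdPathLaw ν₀ h0 κF
  set μ := fwdPathLaw ν₀ κF with hμ
  have hd1 : ∫ ε, Real.exp (ΔF - W ε) ∂μ = 1 := h.integral_density_eq_one hΔF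
  have hdi : Integrable (fun ε => Real.exp (ΔF - W ε)) μ := h.integrable_density h0 ΔF
  have hd2 : Integrable (fun ε => Real.exp (ΔF - W ε) ^ 2) μ := hL2.integrable_sq
  -- `|1 − d|` is in `L²`: variance ≥ 0 gives `(E|1−d|)² ≤ E(1−d)²`
  have hm : AEStronglyMeasurable (fun ε => |1 - Real.exp (ΔF - W ε)|) μ :=
    ((measurable_const.sub (Real.measurable_exp.comp (measurable_const.sub h.measurable_W))).abs).aestronglyMeasurable
  have hsqi : Integrable (fun ε => |1 - Real.exp (ΔF - W ε)| ^ 2) μ := by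
    have hexp : ∀ ε, |1 - Real.exp (ΔF - W ε)| ^ 2 =
        1 - 2 * Real.exp (ΔF - W ε) + Real.exp (ΔF - W ε) ^ 2 := fun ε => by
      rw [sq_abs]; ring
    simp_rw [hexp]
    exact ((integrable_const 1).sub (hdi.const_mul 2)).add hd2
  have hL2' : MemLp (fun ε => |1 - Real.exp (ΔF - W ε)|) 2 μ :=
    (memLp_two_iff_integrable_sq hm).2 hsqi
  have hvar := variance_nonneg (fun ε => |1 - Real.exp (ΔF - W ε)|) μ
  rw [variance_eq_sub hL2'] at hvar
  -- `E(1−d)² = E d² − 1`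
  have hsq : ∫ ε, |1 - Real.exp (ΔF - W ε)| ^ 2 ∂μ = ∫ ε, Real.exp (ΔF - W ε) ^ 2 ∂μ - 1 := by
    have hexp : ∀ ε, |1 - Real.exp (ΔF - W ε)| ^ 2 =
        (1 - 2 * Real.exp (ΔF - W ε)) + Real.exp (ΔF - W ε) ^ 2 := fun ε => by
      rw [sq_abs]; ring
    simp_rw [hexp]
    have hI1 : Integrable (fun ε => 1 - 2 * Real.exp (ΔF - W ε)) μ :=
      (integrable_const 1).sub (hdi.const_mul 2)
    rw [integral_add hI1 hd2, integral_sub (integrable_const 1) (hdi.const_mul 2), integral_const_mul,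
      integral_const, smul_eq_mul, probReal_univ, hd1]
    ring
  have hsq' : μ[(fun ε => |1 - Real.exp (ΔF - W ε)|) ^ 2] = ∫ ε, Real.exp (ΔF - W ε) ^ 2 ∂μ - 1 := by
    rw [← hsq]
    rfl
  -- `1 − acc = ½ E|1 − d|`
  have htv := h.one_sub_accept_eq_half_integral_abs h0 hΔF
  rw [← hμ] at htv
  rw [h.integral_density_sq_eq h0 h1 hΔF, ← hμ] at hsq'
  rw [htv]
  have key : (∫ ε, |1 - Real.exp (ΔF - W ε)| ∂μ) ^ 2 ≤
      (∫ ε, Real.exp (-(2 * W ε)) ∂μ) / (∫ ε, Real.exp (-W ε) ∂μ) ^ 2 - 1 := by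
    have : μ[fun ε => |1 - Real.exp (ΔF - W ε)|] = ∫ ε, |1 - Real.exp (ΔF - W ε)| ∂μ := rfl
    rw [← hsq']
    linarith
  nlinarith [key]

/-- **The ESS-only floor on the acceptance**: `acc ≥ 1 − ½ √(E_F[e^{−2W}]/(E_F e^{−W})² − 1)`
(`= 1 − ½ √(1/ESS_F − 1)`), square-integrable weight. -/
theorem one_sub_half_sqrt_le_accept [IsFiniteMeasure ν₀] [IsFiniteMeasure ν₁] [IsMarkovKernel κF]
    [IsMarkovKernel κR] (h0 : ν₀ univ ≠ 0) (h1 : ν₁ univ ≠ 0) (h : CrooksPair ν₀ ν₁ κF κR s e W)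
    {ΔF : ℝ} (hΔF : Real.exp (-ΔF) = ((ν₀ univ)⁻¹ * ν₁ univ).toReal)
    (hL2 : MemLp (fun ε => Real.exp (ΔF - W ε)) 2 (fwdPathLaw ν₀ κF)) :
    1 - (1 / 2) * Real.sqrt ((∫ ε, Real.exp (-(2 * W ε)) ∂(fwdPathLaw ν₀ κF)) /
          (∫ ε, Real.exp (-W ε) ∂(fwdPathLaw ν₀ κF)) ^ 2 - 1) ≤
      ∫ ε, min 1 (Real.exp (-(W ε - ΔF))) ∂(fwdPathLaw ν₀ κF) := by
  have h4 := h.four_mul_sq_one_sub_accept_le h0 h1 hΔF hL2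
  set a := ∫ ε, min 1 (Real.exp (-(W ε - ΔF))) ∂(fwdPathLaw ν₀ κF)
  set χ := (∫ ε, Real.exp (-(2 * W ε)) ∂(fwdPathLaw ν₀ κF)) /
      (∫ ε, Real.exp (-W ε) ∂(fwdPathLaw ν₀ κF)) ^ 2 - 1
  have hsq : (2 * (1 - a)) ^ 2 ≤ χ := by nlinarith [h4]
  have hle : 2 * (1 - a) ≤ Real.sqrt χ := Real.le_sqrt_of_sq_le hsq
  linarith

/-! ## The ESS against the half-work average and the acceptance -/

/-- **`ESS_F ≤ B²`**, `B = E_F[e^{−(W−ΔF)/2}]`: with `u = e^{−(W−ΔF)/2}` (`u² = d`, `E u² = 1`),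
`1 = (E u²)² ≤ E u · E u³` and `(E u³)² ≤ E u² · E u⁴ = E d²`, so `1 ≤ B² E_F[d²] = B²/ESS_F`. -/
theorem essPop_le_sq_integral_exp_half [IsFiniteMeasure ν₀] [IsFiniteMeasure ν₁] [IsMarkovKernel κF]
    [IsMarkovKernel κR] (h0 : ν₀ univ ≠ 0) (h1 : ν₁ univ ≠ 0) (h : CrooksPair ν₀ ν₁ κF κR s e W)
    {ΔF : ℝ} (hΔF : Real.exp (-ΔF) = ((ν₀ univ)⁻¹ * ν₁ univ).toReal)
    (hL2 : MemLp (fun ε => Real.exp (ΔF - W ε)) 2 (fwdPathLaw ν₀ κF)) :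
    (∫ ε, Real.exp (-W ε) ∂(fwdPathLaw ν₀ κF)) ^ 2 / ∫ ε, Real.exp (-(2 * W ε)) ∂(fwdPathLaw ν₀ κF) ≤
      (∫ ε, Real.exp (-(W ε - ΔF) / 2) ∂(fwdPathLaw ν₀ κF)) ^ 2 := by
  haveI := isProbabilityMeasure_fwdPathLaw ν₀ h0 κF
  set μ := fwdPathLaw ν₀ κF with hμ
  set u : E → ℝ := fun ε => Real.exp (-(W ε - ΔF) / 2) with hu
  have hupos : ∀ ε, 0 < u ε := fun ε => Real.exp_pos _
  -- powers of `u` as exponentials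
  have hu2 : ∀ ε, u ε ^ 2 = Real.exp (ΔF - W ε) := fun ε => by
    rw [hu, sq, ← Real.exp_add]; congr 1; ring
  have hu4 : ∀ ε, u ε ^ 2 * u ε ^ 2 = Real.exp (ΔF - W ε) ^ 2 := fun ε => by rw [hu2, sq]
  -- integrability: `u`, `u²`, `u³ = u·u²`, `u⁴`
  have hum : Measurable u := Real.measurable_exp.comp ((h.measurable_W.sub measurable_const).neg.div_const 2)
  have hui : Integrable u μ := h.integrable_exp_half h0 ΔF
  have hu2i : Integrable (fun ε => u ε ^ 2) μ := by
    simp_rw [hu2]; exact h.integrable_density h0 ΔF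
  have hu4i : Integrable (fun ε => (u ε ^ 2) ^ 2) μ := by
    simp_rw [hu2]; exact hL2.integrable_sq
  have hu3i : Integrable (fun ε => u ε * u ε ^ 2) μ := by
    -- `u³ ≤ (u² + u⁴)/2 ≤ u² + u⁴`
    have hsum : Integrable (fun ε => u ε ^ 2 + (u ε ^ 2) ^ 2) μ := hu2i.add hu4i
    refine hsum.mono' (hum.mul (hum.pow_const 2)).aestronglyMeasurable
      (Eventually.of_forall fun ε => ?_)
    have hp := hupos ε
    rw [Real.norm_eq_abs, abs_of_pos (by positivity)]
    nlinarith [sq_nonneg (u ε - u ε ^ 2), sq_nonneg (u ε), sq_nonneg (u ε ^ 2), hp]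
  have hu3i' : Integrable (fun ε => (u ε * u ε) ^ 2) μ := by
    refine hu4i.congr (Eventually.of_forall fun ε => ?_); simp only; ring
  -- `E u² = 1`
  have hE2 : ∫ ε, u ε ^ 2 ∂μ = 1 := by
    simp_rw [hu2]; exact h.integral_density_eq_one hΔF
  -- first Cauchy–Schwarz: `(E[√u·… ])`: `(∫ u²)² = (∫ u^{1/2}·u^{3/2})²`; we use `f = 1·u^{?}` in the
  -- squared form `(∫ u · u)² ≤ ∫ u ∫ u³`?  No: apply CS to `f = √u`-free pair `(u, u)`-weighted:
  -- `(∫ u²)² = (∫ (u^{1/2}) (u^{3/2}))²`; instead use the pair `f = u^{1/2}`… avoided by the pair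
  -- `(f, g) = (1, u²)` against the measure?  We take the elementary route `(∫ u·u)² ≤ (∫ u)(∫ u·u²)`,
  -- which is CS for `f = √u`, `g = u^{3/2}` rewritten with `f² = u`, `g² = u³`, `fg = u²`.
  have hcs1 : (∫ ε, u ε ^ 2 ∂μ) ^ 2 ≤ (∫ ε, u ε ∂μ) * ∫ ε, u ε * u ε ^ 2 ∂μ := by
    have hf2 : Integrable (fun ε => Real.sqrt (u ε) ^ 2) μ :=
      hui.congr (Eventually.of_forall fun ε => by simp only; rw [Real.sq_sqrt (hupos ε).le])
    have hg2 : Integrable (fun ε => (Real.sqrt (u ε) * u ε) ^ 2) μ :=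
      hu3i.congr (Eventually.of_forall fun ε => by
        simp only; rw [mul_pow, Real.sq_sqrt (hupos ε).le])
    have hfg : Integrable (fun ε => Real.sqrt (u ε) * (Real.sqrt (u ε) * u ε)) μ :=
      hu2i.congr (Eventually.of_forall fun ε => by
        simp only; rw [← mul_assoc, Real.mul_self_sqrt (hupos ε).le, sq])
    have hcs := sq_integral_mul_le hf2 hg2 hfg
    have e1 : ∫ ε, Real.sqrt (u ε) * (Real.sqrt (u ε) * u ε) ∂μ = ∫ ε, u ε ^ 2 ∂μ :=
      integral_congr_ae (Eventually.of_forall fun ε => by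
        simp only; rw [← mul_assoc, Real.mul_self_sqrt (hupos ε).le, sq])
    have e2 : ∫ ε, Real.sqrt (u ε) ^ 2 ∂μ = ∫ ε, u ε ∂μ :=
      integral_congr_ae (Eventually.of_forall fun ε => by simp only; rw [Real.sq_sqrt (hupos ε).le])
    have e3 : ∫ ε, (Real.sqrt (u ε) * u ε) ^ 2 ∂μ = ∫ ε, u ε * u ε ^ 2 ∂μ :=
      integral_congr_ae (Eventually.of_forall fun ε => by
        simp only; rw [mul_pow, Real.sq_sqrt (hupos ε).le, sq])
    rw [e1, e2, e3] at hcs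
    exact hcs
  -- second Cauchy–Schwarz: `(∫ u·u²)² ≤ ∫ u² ∫ u⁴`
  have hcs2 : (∫ ε, u ε * u ε ^ 2 ∂μ) ^ 2 ≤ (∫ ε, u ε ^ 2 ∂μ) * ∫ ε, (u ε ^ 2) ^ 2 ∂μ :=
    sq_integral_mul_le hu2i hu4i hu3i
  rw [hE2, one_pow] at hcs1
  rw [hE2, one_mul] at hcs2
  -- combine: `1 ≤ B · E u³`, `(E u³)² ≤ E u⁴` ⇒ `1 ≤ B² E u⁴`
  have hB0 : 0 ≤ ∫ ε, u ε ∂μ := integral_nonneg fun ε => (hupos ε).le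
  have h3 : 0 ≤ ∫ ε, u ε * u ε ^ 2 ∂μ := integral_nonneg fun ε => by positivity
  have hE4 : ∫ ε, (u ε ^ 2) ^ 2 ∂μ = (∫ ε, Real.exp (-(2 * W ε)) ∂μ) / (∫ ε, Real.exp (-W ε) ∂μ) ^ 2 := by
    rw [← h.integral_density_sq_eq h0 h1 hΔF]
    exact integral_congr_ae (Eventually.of_forall fun ε => by simp only; rw [hu2])
  have hkey : 1 ≤ (∫ ε, u ε ∂μ) ^ 2 * ∫ ε, (u ε ^ 2) ^ 2 ∂μ := by
    nlinarith [hcs1, hcs2, hB0, h3, mul_nonneg hB0 h3]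
  rw [hE4] at hkey
  -- `ESS = 1 / E u⁴ ≤ B²`
  have hr := toReal_ratio_pos (ν₀ := ν₀) (ν₁ := ν₁) h0 h1
  have hEpos : 0 < ∫ ε, Real.exp (-W ε) ∂μ := by rw [hμ, h.integral_exp_neg_work]; exact hr
  have h2i : Integrable (fun ε => Real.exp (-(2 * W ε))) μ := by
    refine (hL2.integrable_sq.const_mul (Real.exp (-ΔF) ^ 2)).congr
      (Eventually.of_forall fun ε => ?_)
    simp only
    rw [sq, sq, ← Real.exp_add, ← Real.exp_add, ← Real.exp_add]
    congr 1
    ring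
  have h2pos : 0 < ∫ ε, Real.exp (-(2 * W ε)) ∂μ := integral_exp_pos h2i
  have hM1sq : 0 < (∫ ε, Real.exp (-W ε) ∂μ) ^ 2 := pow_pos hEpos 2
  rw [div_le_iff₀ h2pos]
  have hmul := mul_le_mul_of_nonneg_right hkey hM1sq.le
  rw [one_mul] at hmul
  calc (∫ ε, Real.exp (-W ε) ∂μ) ^ 2
      ≤ (∫ ε, u ε ∂μ) ^ 2 * ((∫ ε, Real.exp (-(2 * W ε)) ∂μ) / (∫ ε, Real.exp (-W ε) ∂μ) ^ 2) *
          (∫ ε, Real.exp (-W ε) ∂μ) ^ 2 := hmul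
    _ = (∫ ε, u ε ∂μ) ^ 2 * ∫ ε, Real.exp (-(2 * W ε)) ∂μ := by
        field_simp

/-- **`ESS_F ≤ acc · (2 − acc)`** — the population ESS is at most `1 − (1 − acc)²`
(`ESS_F ≤ B² ≤ acc(2 − acc)`, `NCMCGeneralSpaceAcceptanceFloor.sq_integral_exp_half_le`). -/
theorem essPop_le_accept_mul [IsFiniteMeasure ν₀] [IsFiniteMeasure ν₁] [IsMarkovKernel κF]
    [IsMarkovKernel κR] (h0 : ν₀ univ ≠ 0) (h1 : ν₁ univ ≠ 0) (h : CrooksPair ν₀ ν₁ κF κR s e W)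
    {ΔF : ℝ} (hΔF : Real.exp (-ΔF) = ((ν₀ univ)⁻¹ * ν₁ univ).toReal)
    (hL2 : MemLp (fun ε => Real.exp (ΔF - W ε)) 2 (fwdPathLaw ν₀ κF)) :
    (∫ ε, Real.exp (-W ε) ∂(fwdPathLaw ν₀ κF)) ^ 2 / ∫ ε, Real.exp (-(2 * W ε)) ∂(fwdPathLaw ν₀ κF) ≤
      (∫ ε, min 1 (Real.exp (-(W ε - ΔF))) ∂(fwdPathLaw ν₀ κF)) *
        (2 - ∫ ε, min 1 (Real.exp (-(W ε - ΔF))) ∂(fwdPathLaw ν₀ κF)) :=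
  (h.essPop_le_sq_integral_exp_half h0 h1 hΔF hL2).trans (h.sq_integral_exp_half_le h0 hΔF)

/-- **`acc ≥ 1 − √(1 − ESS_F)`** — equivalently `ESS_F ≤ 1 − (1 − acc)²`: a run cannot report a
population ESS above what its rejection rate allows (square-integrable weight). -/
theorem one_sub_sqrt_one_sub_essPop_le_accept [IsFiniteMeasure ν₀] [IsFiniteMeasure ν₁]
    [IsMarkovKernel κF] [IsMarkovKernel κR] (h0 : ν₀ univ ≠ 0) (h1 : ν₁ univ ≠ 0)
    (h : CrooksPair ν₀ ν₁ κF κR s e W) {ΔF : ℝ}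
    (hΔF : Real.exp (-ΔF) = ((ν₀ univ)⁻¹ * ν₁ univ).toReal)
    (hL2 : MemLp (fun ε => Real.exp (ΔF - W ε)) 2 (fwdPathLaw ν₀ κF)) :
    1 - Real.sqrt (1 - (∫ ε, Real.exp (-W ε) ∂(fwdPathLaw ν₀ κF)) ^ 2 /
          ∫ ε, Real.exp (-(2 * W ε)) ∂(fwdPathLaw ν₀ κF)) ≤
      ∫ ε, min 1 (Real.exp (-(W ε - ΔF))) ∂(fwdPathLaw ν₀ κF) := by
  have hle := h.essPop_le_accept_mul h0 h1 hΔF hL2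
  set a := ∫ ε, min 1 (Real.exp (-(W ε - ΔF))) ∂(fwdPathLaw ν₀ κF)
  set ess := (∫ ε, Real.exp (-W ε) ∂(fwdPathLaw ν₀ κF)) ^ 2 /
      ∫ ε, Real.exp (-(2 * W ε)) ∂(fwdPathLaw ν₀ κF)
  have hsq : (1 - a) ^ 2 ≤ 1 - ess := by nlinarith [hle]
  have := Real.le_sqrt_of_sq_le hsq
  linarith

end CrooksPair

end Summit.Ventures.LatticeQCDFlow.Exactness.GeneralNCMC
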